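import Literature.AlgebraicGeometry.Hu2025.Proofs.S04ModelV.GoverningCount
import Literature.AlgebraicGeometry.Hu2025.Proofs.S04ModelV.GoverningEquiv
import Literature.AlgebraicGeometry.Hu2025.Statements.S04ModelV.R105cInstN
import HarnessLib

/-!
# Hu 2025 row 105 — platform instances at `Gr^{3,E}` (kernel; D-lane): leading terms, the within-block (H2′), and the `_ours`
# readings of Def. 4.49 «equivalently» / (4.46) / (4.47) instantiated at `(relN, monoN, headN)`; an AS-TYPED witness at `n = 6`

`relN (headN F) = F`; the leading term of `F̄_{(123),u}` is `(+1, u, m)`; its chart monomial is the single variable `x_u` (H1′); within a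
block, `u_F` divides the chart monomial of no other term (H2′, every rank); for rank-1 blocks `u_F` divides the chart monomial of no other term
of ANY block (res-type-042's (H2)). Hence `Def4_49_equiv_ours`, `Eq4_46_ours` and (finite term type) `Eq4_47_ours` hold at the platform over
every nontrivial coefficient ring, while the free-`F′` AS-PRINTED `Def4_49_equiv` fails at `Gr^{3,6}` (`not_Def4_49_equiv_platform_six`, a
reading artefact). DEDUP NOTE: res-type-042's Lem 4.8 platform file may carry some of the leading-term lemmas under the same names; the later
filer imports the earlier. Bookkeeping on OUR typed carriers of rows 101/103/105 ([claim: Hu2025, status: under-review] statements are candidates, never asserted); nothing about the manuscript's mathematics is decided here. AI-written; weaker than expert review.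
-/

noncomputable section

namespace Literature.AlgebraicGeometry.Hu2025.Proofs.S04ModelV

open Literature.AlgebraicGeometry.Hu2025.Statements.S03Pluecker Literature.AlgebraicGeometry.Hu2025.Statements.S04ModelV

/-- `rel ∘ head = id` at the platform (res-type-042's hypothesis `hhead`). [cite: Hu2025, §3 Def. 3.3 / (3.10)–(3.13) / (3.15), chunks p0017 l.133–139 / p0018 l.17–33, l.48–53 (unrefereed preprint arXiv:2507.21400v1 under adjudication, D-0012/D-0089 — kernel support on OUR typed carriers of rows 103/105; nothing of the source asserted)] -/
theorem relN_headN (n : ℕ) (F : RelIdx n) : relN n (headN n F) = F := rfl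

/-- The term list of an `m`-primary relation starts with its leading term `(+1, u, m)`. [cite: Hu2025, §3 Def. 3.3 / (3.10)–(3.13) / (3.15), chunks p0017 l.133–139 / p0018 l.17–33, l.48–53 (unrefereed preprint arXiv:2507.21400v1 under adjudication, D-0012/D-0089 — kernel support on OUR typed carriers of rows 103/105; nothing of the source asserted)] -/
theorem primaryTerms_eq_cons {u : ℕ × ℕ × ℕ} (hu : IsLt u) :
    ∃ rest : List PlTerm, primaryTerms u = ⟨1, u, mTri⟩ :: rest := by
  unfold primaryTerms
  rw [if_pos hu]
  split_ifs <;> exact ⟨_, rfl⟩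

/-- **The leading term of `F̄_{(123),u}` is `(+1, u, m)`** at the platform. [cite: Hu2025, §3 Def. 3.3 / (3.10)–(3.13) / (3.15), chunks p0017 l.133–139 / p0018 l.17–33, l.48–53 (unrefereed preprint arXiv:2507.21400v1 under adjudication, D-0012/D-0089 — kernel support on OUR typed carriers of rows 103/105; nothing of the source asserted)] -/
theorem termN_headN (n : ℕ) (F : RelIdx n) : termN (headN n F) = ⟨1, F.1.1, mTri⟩ := by
  obtain ⟨rest, hrest⟩ := primaryTerms_eq_cons F.2
  show (primaryTerms F.1.1).get _ = _
  rw [List.get_of_eq hrest]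
  rfl

/-- `m = (123)` is not a Plücker VARIABLE index (`x̄_m = 1`): its exponent vector is `0`. [cite: Hu2025, §3 Def. 3.3 / (3.10)–(3.13) / (3.15), chunks p0017 l.133–139 / p0018 l.17–33, l.48–53 (unrefereed preprint arXiv:2507.21400v1 under adjudication, D-0012/D-0089 — kernel support on OUR typed carriers of rows 103/105; nothing of the source asserted)] -/
theorem plExp_mTri (n : ℕ) : plExp (n := n) mTri = 0 := by
  unfold plExp
  rw [dif_neg]
  simp [plVarSet]

/-- An `m`-primary index `u ∈ 𝕀^lt_{3,n}` is a Plücker variable index (`u ≠ m`). [cite: Hu2025, §3 Def. 3.3 / (3.10)–(3.13) / (3.15), chunks p0017 l.133–139 / p0018 l.17–33, l.48–53 (unrefereed preprint arXiv:2507.21400v1 under adjudication, D-0012/D-0089 — kernel support on OUR typed carriers of rows 103/105; nothing of the source asserted)] -/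
theorem mem_plVarSet_of_relIdx (n : ℕ) (F : RelIdx n) : F.1.1 ∈ plVarSet n := by
  rw [plVarSet, Finset.mem_erase]
  refine ⟨?_, F.1.2⟩
  intro h
  have hlt : IsLt F.1.1 := F.2
  rw [h] at hlt
  revert hlt
  decide

/-- **The chart monomial of the leading term is the single variable `x_u`** (`x̄_u · x̄_m = x_u`): res-type-042's (H1).
[cite: Hu2025, §3 Def. 3.3 / (3.10)–(3.13) / (3.15), chunks p0017 l.133–139 / p0018 l.17–33, l.48–53 (unrefereed preprint arXiv:2507.21400v1 under adjudication, D-0012/D-0089 — kernel support on OUR typed carriers of rows 103/105; nothing of the source asserted)] -/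
theorem monoN_headN (n : ℕ) (F : RelIdx n) :
    monoN n (headN n F) = Finsupp.single ⟨F.1.1, mem_plVarSet_of_relIdx n F⟩ 1 := by
  rw [monoN, termN_headN, plExp_mTri, add_zero]
  unfold plExp
  rw [dif_pos (mem_plVarSet_of_relIdx n F)]

/-- **`Eq4_46_ours` at the platform**: over every nontrivial coefficient ring, the literal `𝓑^gov_F` of `Gr^{3,E}` (`p_{(123)} ≡ 1`)
is `{±B_{F,s} : s ∈ S_F ∖ s_F}` (from `eq4_46_ours_of_nontrivial` and `relN_headN`). [cite: Hu2025, §3 Def. 3.3 / (3.10)–(3.13) / (3.15), chunks p0017 l.133–139 / p0018 l.17–33, l.48–53 (unrefereed preprint arXiv:2507.21400v1 under adjudication, D-0012/D-0089 — kernel support on OUR typed carriers of rows 103/105; nothing of the source asserted)] -/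
theorem eq4_46_ours_platform : ∀ (n : ℕ) (k : Type) [CommRing k] [Nontrivial k],
    Eq4_46_ours (k := k) (relN n) (monoN n) (headN n) :=
  fun n k _ _ => eq4_46_ours_of_nontrivial (k := k) (relN n) (monoN n) (headN n) (relN_headN n)

end Literature.AlgebraicGeometry.Hu2025.Proofs.S04ModelV

end

noncomputable section

namespace Literature.AlgebraicGeometry.Hu2025.Proofs.S04ModelV

open Literature.AlgebraicGeometry.Hu2025.Statements.S03Pluecker Literature.AlgebraicGeometry.Hu2025.Statements.S04ModelV

/-- The term list of an `m`-primary relation: leading term `(+1, u, m)` followed by terms whose two index triples both start with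
`1`, `2` or `3` (read off row 101a's four printed forms). [cite: Hu2025, §3 (3.10)–(3.13) / §4.2 Lem. 4.8 proof, chunks p0018 l.17–33 / p0022 l.92–93 (unrefereed preprint arXiv:2507.21400v1 under adjudication, D-0012/D-0089 — kernel support on OUR typed carriers of rows 103/105; nothing of the source asserted)] -/
theorem primaryTerms_eq_cons_tail {u : ℕ × ℕ × ℕ} (hu : IsLt u) :
    ∃ rest : List PlTerm, primaryTerms u = ⟨1, u, mTri⟩ :: rest ∧
      ∀ t ∈ rest, (t.us.1 = 1 ∨ t.us.1 = 2 ∨ t.us.1 = 3) ∧ (t.vs.1 = 1 ∨ t.vs.1 = 2 ∨ t.vs.1 = 3) := by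
  unfold primaryTerms
  rw [if_pos hu]
  split_ifs <;> refine ⟨_, rfl, ?_⟩ <;> intro t ht <;>
    simp only [List.mem_cons, List.mem_nil_iff, or_false] at ht <;>
    rcases ht with rfl | rfl | rfl <;> simp

/-- Every term of an `m`-primary relation is the leading term `(+1, u, m)` or has both index triples starting with `1`, `2` or `3`.
[cite: Hu2025, §3 (3.10)–(3.13) / §4.2 Lem. 4.8 proof, chunks p0018 l.17–33 / p0022 l.92–93 (unrefereed preprint arXiv:2507.21400v1 under adjudication, D-0012/D-0089 — kernel support on OUR typed carriers of rows 103/105; nothing of the source asserted)] -/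
theorem primaryTerms_mem_cases {u : ℕ × ℕ × ℕ} (hu : IsLt u) {t : PlTerm} (ht : t ∈ primaryTerms u) :
    t = ⟨1, u, mTri⟩ ∨ ((t.us.1 = 1 ∨ t.us.1 = 2 ∨ t.us.1 = 3) ∧ (t.vs.1 = 1 ∨ t.vs.1 = 2 ∨ t.vs.1 = 3)) := by
  obtain ⟨rest, hrest, htail⟩ := primaryTerms_eq_cons_tail hu
  rw [hrest, List.mem_cons] at ht
  rcases ht with rfl | ht
  · exact Or.inl rfl
  · exact Or.inr (htail t ht)

/-- A term of a block at a NON-zero position lies in the tail: both its index triples start with `1`, `2` or `3`. [cite: Hu2025, §3 (3.10)–(3.13) / §4.2 Lem. 4.8 proof, chunks p0018 l.17–33 / p0022 l.92–93 (unrefereed preprint arXiv:2507.21400v1 under adjudication, D-0012/D-0089 — kernel support on OUR typed carriers of rows 103/105; nothing of the source asserted)] -/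
theorem termN_tail {n : ℕ} (F : RelIdx n) (i : C20L5_SF F.1.1) (hi : (i : ℕ) ≠ 0) :
    ((termN (⟨F, i⟩ : TermIdx n)).us.1 = 1 ∨ (termN (⟨F, i⟩ : TermIdx n)).us.1 = 2 ∨ (termN (⟨F, i⟩ : TermIdx n)).us.1 = 3) ∧
    ((termN (⟨F, i⟩ : TermIdx n)).vs.1 = 1 ∨ (termN (⟨F, i⟩ : TermIdx n)).vs.1 = 2 ∨ (termN (⟨F, i⟩ : TermIdx n)).vs.1 = 3) := by
  obtain ⟨rest, hrest, htail⟩ := primaryTerms_eq_cons_tail F.2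
  obtain ⟨j, hj⟩ := Nat.exists_eq_succ_of_ne_zero hi
  apply htail
  show (primaryTerms F.1.1).get i ∈ rest
  rw [List.get_of_eq hrest, List.get_eq_getElem]
  have hlen : j < rest.length := by
    have h := congrArg List.length hrest
    have h2 : (i : ℕ) < (primaryTerms F.1.1).length := i.2
    simp only [List.length_cons] at h
    omega
  simp only [hj, List.getElem_cons_succ]
  exact List.getElem_mem hlen

/-- A rank-`1` primary relation is `F̄_{(123),(abc)}` with `a ∉ {1,2,3}` (the four-term form (3.13)).
[cite: Hu2025, §3 (3.10)–(3.13) / §4.2 Lem. 4.8 proof, chunks p0018 l.17–33 / p0022 l.92–93 (unrefereed preprint arXiv:2507.21400v1 under adjudication, D-0012/D-0089 — kernel support on OUR typed carriers of rows 103/105; nothing of the source asserted)] -/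
theorem fst_notMem_of_rkPrimary_eq_one {u : ℕ × ℕ × ℕ} (hu : IsLt u) (hrk : rkPrimary u = 1) :
    u.1 ≠ 1 ∧ u.1 ≠ 2 ∧ u.1 ≠ 3 := by
  unfold rkPrimary primaryTerms at hrk
  rw [if_pos hu] at hrk
  split_ifs at hrk with h1 h2 h3 <;> simp at hrk
  exact ⟨h1, h2, h3⟩

/-- A support element of `plExp w` is `w` itself. [cite: Hu2025, §3 (3.10)–(3.13) / §4.2 Lem. 4.8 proof, chunks p0018 l.17–33 / p0022 l.92–93 (unrefereed preprint arXiv:2507.21400v1 under adjudication, D-0012/D-0089 — kernel support on OUR typed carriers of rows 103/105; nothing of the source asserted)] -/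
theorem eq_of_mem_support_plExp {n : ℕ} (w : ℕ × ℕ × ℕ) (x : plVar n) (hx : x ∈ (plExp (n := n) w).support) :
    w = x.1 := by
  unfold plExp at hx
  split_ifs at hx with hw
  · rw [Finsupp.mem_support_single] at hx
    exact congrArg Subtype.val hx.1.symm
  · simp at hx

/-- **(H2) at the platform, rank 1**: for a rank-`1` relation `F = F̄_{(123),(abc)}`, the Plücker variable `x_{abc}` divides the
chart monomial of NO term of ANY block other than the leading term of `F` itself (every other index triple starts with `1`, `2` or
`3`, and leading terms of other blocks carry their own `u`) — res-type-042's hypothesis (H2) of `Lem4_8_of_platform`.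
[cite: Hu2025, §3 (3.10)–(3.13) / §4.2 Lem. 4.8 proof, chunks p0018 l.17–33 / p0022 l.92–93 (unrefereed preprint arXiv:2507.21400v1 under adjudication, D-0012/D-0089 — kernel support on OUR typed carriers of rows 103/105; nothing of the source asserted)] -/
theorem uF_notMem_support_monoN_of_rk_one (n : ℕ) (F : RelIdx n) (hrk : rkPrimary F.1.1 = 1)
    (t : TermIdx n) (ht : t ≠ headN n F) :
    (⟨F.1.1, mem_plVarSet_of_relIdx n F⟩ : plVar n) ∉ (monoN n t).support := by
  classical
  obtain ⟨h1, h2, h3⟩ := fst_notMem_of_rkPrimary_eq_one F.2 hrk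
  obtain ⟨F', i⟩ := t
  intro hsupp
  rw [monoN] at hsupp
  have hsupp' := Finsupp.support_add hsupp
  rw [Finset.mem_union] at hsupp'
  -- the support element is `u_F`, so `u_F ∈ {us, vs}` of the term
  have hw : (termN (⟨F', i⟩ : TermIdx n)).us = F.1.1 ∨ (termN (⟨F', i⟩ : TermIdx n)).vs = F.1.1 := by
    rcases hsupp' with h | h
    · exact Or.inl (eq_of_mem_support_plExp _ _ h)
    · exact Or.inr (eq_of_mem_support_plExp _ _ h)
  by_cases hi : (i : ℕ) = 0
  · -- the leading term of the block `F′`: `us = u_{F′}`, `vs = m`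
    have hval : termN (⟨F', i⟩ : TermIdx n) = ⟨1, F'.1.1, mTri⟩ := by
      have : (⟨F', i⟩ : TermIdx n) = headN n F' := by
        simp only [headN, Sigma.mk.injEq, heq_eq_eq, true_and]
        exact Fin.ext hi
      rw [this, termN_headN]
    rw [hval] at hw
    simp only at hw
    rcases hw with hw | hw
    · -- `u_{F′} = u_F` ⇒ `F′ = F` ⇒ `t = headN F`
      apply ht
      have hF : F' = F := Subtype.ext (Subtype.ext hw)
      subst hF
      simp only [headN, Sigma.mk.injEq, heq_eq_eq, true_and]
      exact Fin.ext hi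
    · -- `m = u_F`: impossible, `m.1 = 1`
      have := congrArg Prod.fst hw
      simp [mTri] at this
      omega
  · -- a tail term: both triples start with `1`, `2` or `3`, but `u_F.1 ∉ {1,2,3}`
    obtain ⟨hus, hvs⟩ := termN_tail F' i hi
    rcases hw with hw | hw
    · rw [hw] at hus; omega
    · rw [hw] at hvs; omega

end Literature.AlgebraicGeometry.Hu2025.Proofs.S04ModelV

end

noncomputable section

namespace Literature.AlgebraicGeometry.Hu2025.Proofs.S04ModelV

open Literature.AlgebraicGeometry.Hu2025.Statements.S03Pluecker Literature.AlgebraicGeometry.Hu2025.Statements.S04ModelV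

/-- Tail terms of a rank-`0` relation `F̄_{(123),(iuv)}`, `i ∈ {1,2,3}`: both index triples have SECOND coordinate `2` or `3`
(forms (3.10)–(3.12)). [cite: Hu2025, §3 (3.10)–(3.13) / §4.5 Def. 4.49, chunks p0018 l.17–33 / p0031 l.165–166 (unrefereed preprint arXiv:2507.21400v1 under adjudication, D-0012/D-0089 — kernel support on OUR typed carriers of rows 103/105; nothing of the source asserted)] -/
theorem primaryTerms_tail_snd {u : ℕ × ℕ × ℕ} (hu : IsLt u) (h123 : u.1 = 1 ∨ u.1 = 2 ∨ u.1 = 3) :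
    ∃ rest : List PlTerm, primaryTerms u = ⟨1, u, mTri⟩ :: rest ∧
      ∀ t ∈ rest, (t.us.2.1 = 2 ∨ t.us.2.1 = 3) ∧ (t.vs.2.1 = 2 ∨ t.vs.2.1 = 3) := by
  unfold primaryTerms
  rw [if_pos hu]
  rcases h123 with h | h | h <;> simp only [h] <;> refine ⟨_, rfl, ?_⟩ <;> intro t ht <;>
    simp only [List.mem_cons, List.mem_nil_iff, or_false] at ht <;>
    rcases ht with rfl | rfl <;> simp

/-- For `u ∈ 𝕀^lt_{3,n}` with `u₁ ∈ {1,2,3}` (rank `0`), the other two entries avoid `{1,2,3}`: `3 < u₂`. [cite: Hu2025, §3 (3.10)–(3.13) / §4.5 Def. 4.49, chunks p0018 l.17–33 / p0031 l.165–166 (unrefereed preprint arXiv:2507.21400v1 under adjudication, D-0012/D-0089 — kernel support on OUR typed carriers of rows 103/105; nothing of the source asserted)] -/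
theorem three_lt_snd_of_isLt {u : ℕ × ℕ × ℕ} (hu : IsLt u) (hincr : u.1 < u.2.1) (h123 : u.1 = 1 ∨ u.1 = 2 ∨ u.1 = 3) :
    3 < u.2.1 := by
  by_contra hle
  push Not at hle
  unfold IsLt triSet mSet at hu
  have hsub : ({u.1, u.2.1, u.2.2} : Finset ℕ) \ {1, 2, 3} ⊆ {u.2.2} := by
    intro x hx
    simp only [Finset.mem_sdiff, Finset.mem_insert, Finset.mem_singleton, not_or] at hx
    simp only [Finset.mem_singleton]
    omega
  have := (Finset.card_le_card hsub).trans (Finset.card_singleton _).le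
  omega

/-- **(H2′) at the platform, WITHIN the block, every rank**: `u_F` divides the chart monomial of no term of `F̄` other than the
leading one (rank 1: the other index triples start with `1`, `2`, `3` while `u₁ ≥ 4`; rank 0: their second entries are `2` or `3`
while `u₂ ≥ 4`). Hypothesis (H2′) of `def4_49_equiv_ours_of_leading` at `Gr^{3,E}`. [cite: Hu2025, §3 (3.10)–(3.13) / §4.5 Def. 4.49, chunks p0018 l.17–33 / p0031 l.165–166 (unrefereed preprint arXiv:2507.21400v1 under adjudication, D-0012/D-0089 — kernel support on OUR typed carriers of rows 103/105; nothing of the source asserted)] -/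
theorem uF_notMem_support_monoN_within (n : ℕ) (F : RelIdx n) (t : TermIdx n) (hF : relN n t = F)
    (ht : t ≠ headN n F) (s : plVar n) (hs : monoN n (headN n F) = Finsupp.single s 1) :
    s ∉ (monoN n t).support := by
  classical
  -- `s = x_{u_F}`
  have hs' : s = ⟨F.1.1, mem_plVarSet_of_relIdx n F⟩ := by
    rw [monoN_headN] at hs
    exact Finsupp.single_left_injective one_ne_zero |>.eq_iff.mp hs.symm
  subst hs'
  obtain ⟨F', i⟩ := t
  simp only [relN] at hF
  subst hF
  -- the index is not `0`
  have hi : (i : ℕ) ≠ 0 := by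
    intro h0
    apply ht
    simp only [headN, Sigma.mk.injEq, heq_eq_eq, true_and]
    exact Fin.ext h0
  intro hsupp
  rw [monoN] at hsupp
  have hw : (termN (⟨F', i⟩ : TermIdx n)).us = F'.1.1 ∨ (termN (⟨F', i⟩ : TermIdx n)).vs = F'.1.1 := by
    rcases Finset.mem_union.mp (Finsupp.support_add hsupp) with h | h
    · exact Or.inl (eq_of_mem_support_plExp _ _ h)
    · exact Or.inr (eq_of_mem_support_plExp _ _ h)
  -- increasing triple: `u₁ < u₂`
  have hincr : F'.1.1.1 < F'.1.1.2.1 := by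
    have hmem := F'.1.2
    simp only [plIndexSet, Finset.mem_filter] at hmem
    exact hmem.2.1
  obtain ⟨hus, hvs⟩ := termN_tail F' i hi
  by_cases h123 : F'.1.1.1 = 1 ∨ F'.1.1.1 = 2 ∨ F'.1.1.1 = 3
  · -- rank 0: compare SECOND coordinates
    have h4 := three_lt_snd_of_isLt F'.2 hincr h123
    obtain ⟨rest, hrest, htail⟩ := primaryTerms_tail_snd F'.2 h123
    obtain ⟨j, hj⟩ := Nat.exists_eq_succ_of_ne_zero hi
    have hmem : termN (⟨F', i⟩ : TermIdx n) ∈ rest := by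
      show (primaryTerms F'.1.1).get i ∈ rest
      rw [List.get_of_eq hrest, List.get_eq_getElem]
      have hlen : j < rest.length := by
        have h := congrArg List.length hrest
        have h2 : (i : ℕ) < (primaryTerms F'.1.1).length := i.2
        simp only [List.length_cons] at h
        omega
      simp only [hj, List.getElem_cons_succ]
      exact List.getElem_mem hlen
    obtain ⟨hus2, hvs2⟩ := htail _ hmem
    rcases hw with hw | hw
    · rw [hw] at hus2; omega
    · rw [hw] at hvs2; omega
  · -- rank 1: compare FIRST coordinates
    push Not at h123
    rcases hw with hw | hw
    · rw [hw] at hus; omega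
    · rw [hw] at hvs; omega

/-- **`Def4_49_equiv_ours` at the platform**: over every nontrivial coefficient ring, for every ℘-binomial of a block `F` of
`Gr^{3,E}`, «contains `x_{((123),u_F)}`» ⇔ «contains `x_{u_F}`» (H1′ = `monoN_headN`, H2′ = `uF_notMem_support_monoN_within`).
[cite: Hu2025, §3 (3.10)–(3.13) / §4.5 Def. 4.49, chunks p0018 l.17–33 / p0031 l.165–166 (unrefereed preprint arXiv:2507.21400v1 under adjudication, D-0012/D-0089 — kernel support on OUR typed carriers of rows 103/105; nothing of the source asserted)] -/
theorem def4_49_equiv_ours_platform : ∀ (n : ℕ) (k : Type) [CommRing k] [Nontrivial k],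
    Def4_49_equiv_ours (k := k) (relN n) (monoN n) (headN n) :=
  fun n k _ _ => def4_49_equiv_ours_of_leading (k := k) (relN n) (monoN n) (headN n)
    (fun F => ⟨_, monoN_headN n F⟩)
    (fun F t hF ht s hs => uF_notMem_support_monoN_within n F t hF ht s hs)

end Literature.AlgebraicGeometry.Hu2025.Proofs.S04ModelV

end

noncomputable section

namespace Literature.AlgebraicGeometry.Hu2025.Proofs.S04ModelV

open Literature.AlgebraicGeometry.Hu2025.Statements.S04ModelV

/-- **`Eq4_47_ours` at the platform** (finite term type, nontrivial coefficients).
[cite: Hu2025, §4.5 (4.47), chunk p0032 l.41–49 (unrefereed preprint arXiv:2507.21400v1 under adjudication, D-0012/D-0089 — kernel support on OUR typed carriers of rows 103/105; nothing of the source asserted)] -/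
theorem eq4_47_ours_platform : ∀ (n : ℕ) (k : Type) [CommRing k] [Nontrivial k],
    Eq4_47_ours (k := k) (relN n) (monoN n) (headN n) :=
  fun n k _ _ => eq4_47_ours_of_nontrivial (k := k) (relN n) (monoN n) (headN n) (relN_headN n)

end Literature.AlgebraicGeometry.Hu2025.Proofs.S04ModelV

end

noncomputable section

namespace Literature.AlgebraicGeometry.Hu2025.Proofs.S04ModelV

open MvPolynomial Literature.AlgebraicGeometry.Hu2025.Statements.S03Pluecker
  Literature.AlgebraicGeometry.Hu2025.Statements.S04ModelV

/-- **`Def4_49_equiv` AS PRINTED (free `F′`) is refutable AS TYPED at the platform `Gr^{3,6}`** over every nontrivial coefficient ring: the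
℘-binomial of the terms `x_{124}x_{356}` and `x_{134}x_{256}` of `F̄_{(123),(456)}` contains the leading ϖ-variable `x_{356}` of
`F̄_{(123),(356)}` but no leading ϱ-variable (neither of its two ϱ-variables is a term at position `0`). READING artefact — the block-own
reading holds at the platform (`def4_49_equiv_ours_platform`); «refutable as typed», not «refuted in print».
[cite: Hu2025, §3 (3.13) at n = 6 / §4.5 Def. 4.49, chunks p0018 l.30–33 / p0031 l.165–166 (unrefereed preprint arXiv:2507.21400v1 under adjudication, D-0012/D-0089 — kernel support on OUR typed carriers of rows 103/105; nothing of the source asserted)] -/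
theorem not_Def4_49_equiv_platform_six : ∀ (k : Type) [CommRing k] [Nontrivial k],
    ¬ Def4_49_equiv (k := k) (relN 6) (monoN 6) (headN 6) := by
  intro k _ _ h
  -- the block `F̄_{(123),(456)}`, its terms at positions 1 and 2, and the block `F̄_{(123),(356)}`
  let F456 : RelIdx 6 := ⟨⟨(4, 5, 6), by decide⟩, by decide⟩
  let s : TermIdx 6 := ⟨F456, ⟨1, by decide⟩⟩
  let t : TermIdx 6 := ⟨F456, ⟨2, by decide⟩⟩
  let F356 : RelIdx 6 := ⟨⟨(3, 5, 6), by decide⟩, by decide⟩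
  have hst : s ≠ t := by decide
  have hs_us : (termN s).us = (1, 2, 4) := by decide
  have hs_vs : (termN s).vs = (3, 5, 6) := by decide
  have hhead_s : ∀ G : RelIdx 6, headN 6 G ≠ s := by decide
  have hhead_t : ∀ G : RelIdx 6, headN 6 G ≠ t := by decide
  -- `x_{356}` divides the chart monomial `x̄_{124} x̄_{356}` of `s`
  have hsupp : (⟨(3, 5, 6), by decide⟩ : plVar 6) ∈ (monoN 6 s).support := by
    rw [Finsupp.mem_support_iff, monoN, hs_us, hs_vs, Finsupp.add_apply]
    unfold plExp
    rw [dif_pos (by decide : ((1, 2, 4) : ℕ × ℕ × ℕ) ∈ plVarSet 6),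
      dif_pos (by decide : ((3, 5, 6) : ℕ × ℕ × ℕ) ∈ plVarSet 6),
      Finsupp.single_eq_of_ne (by decide), Finsupp.single_eq_same]
    decide
  have hf : wpBinomial (k := k) (monoN 6) s t ∈ wpBinomials (k := k) (relN 6) (monoN 6) Set.univ :=
    ⟨s, t, rfl, hst, Set.mem_univ _, rfl, wpBinomial_ne_zero (monoN 6) hst⟩
  have hiff := h _ hf
  -- RHS holds: `x_{356} = x̄_{head F356}` occurs
  have hR : ContainsLeadingVarpiVar (k := k) (monoN 6) (headN 6) (wpBinomial (k := k) (monoN 6) s t) := by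
    refine ⟨F356, ⟨(3, 5, 6), by decide⟩, monoN_headN 6 F356, ?_⟩
    exact (inl_mem_vars_wpBinomial_iff (monoN 6) hst _).mpr (Or.inl hsupp)
  -- LHS fails: neither `s` nor `t` is a leading term
  obtain ⟨G, hG⟩ := hiff.mpr hR
  rcases (inr_mem_vars_wpBinomial_iff (monoN 6) hst _).mp hG with h1 | h1
  · exact hhead_s G h1
  · exact hhead_t G h1

end Literature.AlgebraicGeometry.Hu2025.Proofs.S04ModelV

end
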